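import Mathlib
import Summits.AtomisticToContinuum.FouriersLaw.Theses.BondHeatUncertainty
import Summits.AtomisticToContinuum.FouriersLaw.Theses.FeketeSeriesLaw
import Summits.AtomisticToContinuum.FouriersLaw.Theses.JunctionLocality
import Summits.AtomisticToContinuum.FouriersLaw.Theses.LocalOhmBV
import Summits.AtomisticToContinuum.FouriersLaw.Theses.FourierGreenKubo
import Summits.AtomisticToContinuum.FouriersLaw.Theorems.BondHeatUncertaintyPositiveOrInfiniteLimit

/-!
# Route `BondHeatUncertainty` — the import slot `PositiveOrInfiniteLimit` against the conjunct and
# against the sibling slot `BoundedResponseConverges`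

Support for item `stmt-AtomisticToContinuum-9128`
(`Summit.AtomisticToContinuum.FouriersLaw.Theses.BondHeatUncertainty.PositiveOrInfiniteLimit`: under
weak-NESS uniqueness, along every steady-state family of `pinnedChain ω₂ lam β γ` and every `T > 0`,
the response coefficients `D N` converge in `EReal` to some `ℓ ∈ (0, +∞]`). Unconditionally the slot
is the positivity-and-convergence half of Fourier's law for a deterministic anharmonic bulk (open,
BLR 2000 §6.3); the companion file `BondHeatUncertaintyPositiveOrInfiniteLimit.lean` lands the two
Fekete supply lines. This file places the slot exactly among the neighbouring ledger statements, all
BY NAME: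

* `positiveOrInfiniteLimit_of_fouriersLaw : FouriersLaw → PositiveOrInfiniteLimit` — NECESSITY: the
  slot is implied by the sub-problem Statement itself (clause (ii) gives `D N → κ T > 0`, and the
  `δ`-limits along `𝓝[≠] 0` are unique), so it cannot be refuted without refuting the conjunct, and
  any route that closes `FouriersLaw` closes item 9128 by one application.
* `positiveOrInfiniteLimit_of_fourierGreenKubo : FourierGreenKubo.FourierGreenKubo →
  FourierGreenKubo.ThermodynamicLimit → PositiveOrInfiniteLimit` — a supply line from the two cruxes
  of route `FourierGreenKubo` (items 0703, 0742) ALONE: the thermodynamic-limit crux sends every response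
  sequence to the Green–Kubo conductivity, positive by `HasGreenKubo.pos`; the slot's own hypotheses
  (uniqueness, the family, existence of `D`) are exactly what that crux consumes, so neither
  `NessUnique` nor `FiniteResponseOfUnique` is needed (unlike that route's Assembly).
* `boundedResponseConverges_of_positiveOrInfiniteLimit : PositiveOrInfiniteLimit →
  LocalOhmBV.BoundedResponseConverges` — the slot IMPLIES the shared slot
  `stmt-AtomisticToContinuum-9141` of routes `LocalOhmBV` / `MatthiessenLadder` /
  `OddSectorIrreversibility` / `TransferKernelPositivity` ("bounded response ⇒ `D N → k > 0`"): an
  `EReal` limit `ℓ > 0` of a bounded real sequence is real and positive. Hence every supplier of 9128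
  (the Fekete lines, the Green–Kubo line) supplies 9141: `boundedResponseConverges_of_feketeSeriesLaw`,
  `boundedResponseConverges_of_junctionLocality`, `boundedResponseConverges_of_fourierGreenKubo`.
* `positiveOrInfiniteLimit_of_boundedResponseConverges : LocalOhmBV.BoundedResponseConverges →
  LocalOhmBV.BoundedResponse → PositiveOrInfiniteLimit` (and the primed form with this route's
  uniqueness-free `BondHeatUncertainty.BoundedResponse`, item 11071, which route `BondHeatUncertainty`
  OUTPUTS through `TransferToBoundedResponse`) — the converse modulo bounded response: a fourth supply
  line, 9128 ⟸ 9141 ∧ 10924 (resp. 9141 ∧ 11071).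

So, modulo `BoundedResponse`, items 9128 and 9141 are ONE statement (the tenure planner may merge or
re-point them); nothing here closes 9128, which stays open on the cruxes recorded in the companion file.
-/

noncomputable section

open Filter Topology Set

namespace Summit.AtomisticToContinuum.FouriersLaw.Theorems.PositiveOrInfiniteLimit

open Summit.AtomisticToContinuum.FouriersLaw.Theses

/-! ## An `EReal` limit of a bounded real sequence -/

/-- If a real sequence `D` with `|D N| ≤ S`-type bound (`BddAbove (range |D ·|)`) converges in `EReal`
to some `ℓ > 0`, then `ℓ` is (the coercion of) a positive real `k` and `D N → k` in `ℝ`: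
`ℓ ≤ ↑S < ⊤`, `⊥ < 0 < ℓ`, so `ℓ = ↑ℓ.toReal` and `EReal.tendsto_coe` applies. [folklore] -/
theorem exists_pos_tendsto_of_ereal_tendsto_of_bddAbove (D : ℕ → ℝ)
    (hbdd : BddAbove (Set.range fun N => |D N|)) {ℓ : EReal} (hℓpos : 0 < ℓ)
    (hℓ : Tendsto (fun N : ℕ => ((D N : ℝ) : EReal)) atTop (𝓝 ℓ)) :
    ∃ k : ℝ, 0 < k ∧ Tendsto D atTop (𝓝 k) := by
  obtain ⟨S, hS⟩ := hbdd
  have hDle : ∀ N : ℕ, ((D N : ℝ) : EReal) ≤ ((S : ℝ) : EReal) := fun N =>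
    EReal.coe_le_coe_iff.2 ((le_abs_self _).trans (hS ⟨N, rfl⟩))
  have hℓle : ℓ ≤ ((S : ℝ) : EReal) := le_of_tendsto' hℓ hDle
  have hℓtop : ℓ ≠ ⊤ := ne_top_of_le_ne_top (EReal.coe_ne_top S) hℓle
  have hℓbot : ℓ ≠ ⊥ := ne_bot_of_gt hℓpos
  have hcoe : ((ℓ.toReal : ℝ) : EReal) = ℓ := EReal.coe_toReal hℓtop hℓbot
  refine ⟨ℓ.toReal, ?_, ?_⟩
  · have h0 : ((0 : ℝ) : EReal) < ((ℓ.toReal : ℝ) : EReal) := by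
      rw [hcoe]
      exact_mod_cast hℓpos
    exact EReal.coe_lt_coe_iff.1 h0
  · have h' : Tendsto (fun N : ℕ => ((D N : ℝ) : EReal)) atTop (𝓝 ((ℓ.toReal : ℝ) : EReal)) := by
      rw [hcoe]
      exact hℓ
    exact EReal.tendsto_coe.1 h'

/-! ## Necessity: the conjunct implies the slot -/

/-- **`FouriersLaw → PositiveOrInfiniteLimit`** (the sub-problem Statement by name ⇒ the route decl):
fix parameters, uniqueness, a steady-state family `μ`, `T > 0` and response coefficients `D`; clause
(ii) of `FouriersLawFor (pinnedChain ω₂ lam β γ)` provides, along the same family, coefficients `D'`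
with `D' N → κ T > 0`; the two `δ`-limits along the proper filter `𝓝[≠] 0` agree
(`tendsto_nhds_unique`), so `D = D'` and `↑(D N) → ↑(κ T)`, a positive `EReal`. The uniqueness
hypothesis of the slot is not even used. [folklore] -/
theorem positiveOrInfiniteLimit_of_fouriersLaw (hF : FouriersLaw) :
    BondHeatUncertainty.PositiveOrInfiniteLimit := by
  intro ω₂ lam β γ hω hl hβ hγ _huniq μ hμ T hT D hD
  obtain ⟨-, κ, hκ, hclause⟩ := hF ω₂ lam β γ hω hl hβ hγ
  obtain ⟨D', hD', hlim⟩ := hclause μ hμ T hT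
  have hDD' : D = D' := funext fun N => tendsto_nhds_unique (hD N) (hD' N)
  subst hDD'
  exact ⟨((κ T : ℝ) : EReal), EReal.coe_pos.2 (hκ T hT),
    (continuous_coe_real_ereal.tendsto _).comp hlim⟩

/-! ## The Green–Kubo supply line (route `FourierGreenKubo`) -/

/-- **`FourierGreenKubo → ThermodynamicLimit → PositiveOrInfiniteLimit`** (the two cruxes of route
`FourierGreenKubo`, items `stmt-AtomisticToContinuum-0703` and `-0742`, by name ⇒ the route decl of
`BondHeatUncertainty`): fix parameters, the uniqueness hypothesis, a steady-state family `μ`, `T > 0`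
and response coefficients `D`; crux 0703 supplies the infinite-volume setup at `T` (Gibbs state,
measure-preserving dynamics, Green–Kubo), crux 0742 then yields a Green–Kubo pair `(μT, D∞)` with
`D N → κ_GK := D∞.greenKuboConductivity μT T` along EVERY steady-state family, and `κ_GK > 0` is part of
`HasGreenKubo` (`HasGreenKubo.pos`); coerce into `EReal`. [folklore] -/
theorem positiveOrInfiniteLimit_of_fourierGreenKubo
    (hGK : FourierGreenKubo.FourierGreenKubo) (hTL : FourierGreenKubo.ThermodynamicLimit) :
    BondHeatUncertainty.PositiveOrInfiniteLimit := by
  intro ω₂ lam β γ hω hl hβ hγ huniq μ hμ T hT D hD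
  obtain ⟨μT, Dyn, -, -, hGKT, hlim⟩ :=
    hTL ω₂ lam β γ hω hl hβ hγ huniq T hT (hGK ω₂ lam β γ hω hl hβ hγ T hT)
  exact ⟨((Dyn.greenKuboConductivity μT T : ℝ) : EReal), EReal.coe_pos.2 hGKT.pos,
    (continuous_coe_real_ereal.tendsto _).comp (hlim μ hμ D hD)⟩

/-! ## The slot implies the sibling slot `BoundedResponseConverges` (item 9141) -/

/-- **`PositiveOrInfiniteLimit → BoundedResponseConverges`** (route decl of `BondHeatUncertainty` ⇒
route decl of `LocalOhmBV`, item `stmt-AtomisticToContinuum-9141`, shared verbatim by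
`MatthiessenLadder`, `OddSectorIrreversibility`, `TransferKernelPositivity`): both statements carry the
same parameters, uniqueness hypothesis, family, `T` and `D`; the slot gives an `EReal` limit `ℓ > 0`,
and under the extra hypothesis `BddAbove (range |D ·|)` of 9141 that limit is a positive real
(`exists_pos_tendsto_of_ereal_tendsto_of_bddAbove`). So every supplier of item 9128 supplies item
9141. [folklore] -/
theorem boundedResponseConverges_of_positiveOrInfiniteLimit
    (hL : BondHeatUncertainty.PositiveOrInfiniteLimit) : LocalOhmBV.BoundedResponseConverges := by
  intro ω₂ lam β γ hω hl hβ hγ huniq μ hμ T hT D hD hbdd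
  obtain ⟨ℓ, hℓpos, hℓ⟩ := hL ω₂ lam β γ hω hl hβ hγ huniq μ hμ T hT D hD
  exact exists_pos_tendsto_of_ereal_tendsto_of_bddAbove D hbdd hℓpos hℓ

/-- **Fekete supply line for item 9141**: `FeketeSeriesLaw.PositiveConductance →
FeketeSeriesLaw.QuasiSubadditiveResistance → LocalOhmBV.BoundedResponseConverges`, by composing
`positiveOrInfiniteLimit_of_feketeSeriesLaw` with `boundedResponseConverges_of_positiveOrInfiniteLimit`.
[folklore] -/
theorem boundedResponseConverges_of_feketeSeriesLaw
    (hP : FeketeSeriesLaw.PositiveConductance) (hS : FeketeSeriesLaw.QuasiSubadditiveResistance) :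
    LocalOhmBV.BoundedResponseConverges :=
  boundedResponseConverges_of_positiveOrInfiniteLimit (positiveOrInfiniteLimit_of_feketeSeriesLaw hP hS)

/-- **Superadditive supply line for item 9141**: `JunctionLocality.PositiveConductance →
ConductanceLowerBound → SuperadditiveResistance → LocalOhmBV.BoundedResponseConverges`, by composing
`positiveOrInfiniteLimit_of_junctionLocality` with `boundedResponseConverges_of_positiveOrInfiniteLimit`
(no non-ballisticity needed). [folklore] -/
theorem boundedResponseConverges_of_junctionLocality
    (hP : JunctionLocality.PositiveConductance) (hC : JunctionLocality.ConductanceLowerBound)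
    (hA : JunctionLocality.SuperadditiveResistance) : LocalOhmBV.BoundedResponseConverges :=
  boundedResponseConverges_of_positiveOrInfiniteLimit (positiveOrInfiniteLimit_of_junctionLocality hP hC hA)

/-- **Green–Kubo supply line for item 9141**: `FourierGreenKubo.FourierGreenKubo →
FourierGreenKubo.ThermodynamicLimit → LocalOhmBV.BoundedResponseConverges` (here the boundedness
hypothesis of 9141 is idle: the limit is the real number `κ_GK > 0` outright). [folklore] -/
theorem boundedResponseConverges_of_fourierGreenKubo
    (hGK : FourierGreenKubo.FourierGreenKubo) (hTL : FourierGreenKubo.ThermodynamicLimit) :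
    LocalOhmBV.BoundedResponseConverges :=
  boundedResponseConverges_of_positiveOrInfiniteLimit (positiveOrInfiniteLimit_of_fourierGreenKubo hGK hTL)

/-! ## The converse modulo bounded response: a fourth supply line for the slot -/

/-- **`BoundedResponseConverges → BoundedResponse → PositiveOrInfiniteLimit`** with BOTH hypotheses the
route decls of `LocalOhmBV` (items 9141 and 10924, the latter = bounded response UNDER weak-NESS
uniqueness): fix the data of the slot; 10924 gives `BddAbove (range |D ·|)`, 9141 then gives a real
limit `k > 0`, and the coercion `ℝ → EReal` is continuous. Together with
`boundedResponseConverges_of_positiveOrInfiniteLimit`: modulo bounded response, items 9128 and 9141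
are the same statement. [folklore] -/
theorem positiveOrInfiniteLimit_of_boundedResponseConverges
    (hC : LocalOhmBV.BoundedResponseConverges) (hB : LocalOhmBV.BoundedResponse) :
    BondHeatUncertainty.PositiveOrInfiniteLimit := by
  intro ω₂ lam β γ hω hl hβ hγ huniq μ hμ T hT D hD
  have hbdd := hB ω₂ lam β γ hω hl hβ hγ huniq μ hμ T hT D hD
  obtain ⟨k, hk, hlim⟩ := hC ω₂ lam β γ hω hl hβ hγ huniq μ hμ T hT D hD hbdd
  exact ⟨((k : ℝ) : EReal), EReal.coe_pos.2 hk, (continuous_coe_real_ereal.tendsto _).comp hlim⟩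

/-- **`BoundedResponseConverges → BondHeatUncertainty.BoundedResponse → PositiveOrInfiniteLimit`**: the
same fourth supply line fed with THIS route's uniqueness-free bounded-response waypoint (item 11071,
the output of `TransferToBoundedResponse`), which trivially implies the `LocalOhmBV` form. [folklore] -/
theorem positiveOrInfiniteLimit_of_boundedResponseConverges'
    (hC : LocalOhmBV.BoundedResponseConverges) (hB : BondHeatUncertainty.BoundedResponse) :
    BondHeatUncertainty.PositiveOrInfiniteLimit :=
  positiveOrInfiniteLimit_of_boundedResponseConverges hC
    fun ω₂ lam β γ hω hl hβ hγ _ μ hμ T hT D hD => hB ω₂ lam β γ hω hl hβ hγ μ hμ T hT D hD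

/-- **Inside route `BondHeatUncertainty`**: its transfer glue and three cruxes (all by name) together
with weak-NESS uniqueness reduce the slot to the sibling slot 9141 —
`TransferToBoundedResponse → SubdiffusiveBondHeat → ExtensiveSnapshotIrreversibility →
LinearResponseFTUR → NessUnique → LocalOhmBV.BoundedResponseConverges → PositiveOrInfiniteLimit`.
[folklore] -/
theorem positiveOrInfiniteLimit_of_route_and_boundedResponseConverges
    (hT : BondHeatUncertainty.TransferToBoundedResponse) (hS : BondHeatUncertainty.SubdiffusiveBondHeat)
    (hK : BondHeatUncertainty.ExtensiveSnapshotIrreversibility)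
    (hF : BondHeatUncertainty.LinearResponseFTUR) (hU : BondHeatUncertainty.NessUnique)
    (hC : LocalOhmBV.BoundedResponseConverges) : BondHeatUncertainty.PositiveOrInfiniteLimit :=
  positiveOrInfiniteLimit_of_boundedResponseConverges' hC (hT hS hK hF hU)

end Summit.AtomisticToContinuum.FouriersLaw.Theorems.PositiveOrInfiniteLimit

end
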